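import Summits.Ventures.PercRepro.S1NullityChain
import Summits.Ventures.PercRepro.TriangleCapEightI

/-!
# PercRepro — THE CHAIN OF TRIANGLES WITH THE RESTRICTION CAP AND A DISJOINT SUBFAMILY (p2, gen 23; SUBCLAIM-S1 §6.8)

Three facts the nullity lever (S1NullityChain) did not use. (1) The `e`-free partition property passes to every
restriction `M ↾ S` (closure is monotone and `(M ↾ S).closure X = M.closure X ∩ S`), so p3's triangle cap `cq3`
bounds the triangles INSIDE any `S ⊆ E` by `cq3 (ν(S))`: when the greedy chain stops early with every triangle inside
its union `S`, the nullity of `S` is `≥ r` as soon as `cq3 (r − 1) < s₃` — far beyond Lemma T's `(r − 1)·r < 2·s₃`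
(`cq3⁻¹(7) = 5`, `cq3⁻¹(8) = 6` against `4`, `4`). (2) The chain keeps a greedy PAIRWISE DISJOINT subfamily `𝒟`: a
new triangle disjoint from `⋃𝒟` joins `𝒟` and adds `≤ 3` points, one meeting `⋃𝒟` adds `≤ 2` — so `|S| ≤ 2j + |𝒟|`
after `j` steps, i.e. a chain with a large union has many pairwise disjoint members (`|𝒟| ≥ |S| − 2r`), and the
`p`-supersets of two DISJOINT triangles overlap in only `C(n − 6, p − 6)` sets (S1ChainKill).

* `hfree_restrict` — the `e`-free partitions survive restriction;
* `ncard_triangles_subset_le_cq3` — `#{T ⊆ S} ≤ cq3 (ν(S))`;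
* **`exists_chain_set`** — the chain dichotomy: `S` of nullity `≥ r` with a pairwise disjoint `𝒟 ⊆ S`, and either
  `|S| ≤ 2r + |𝒟|` with `≤ s₃ − r` triangles outside `S`, or `|S| + 2 ≤ 2r + |𝒟|` with every triangle inside `S`.
Axioms: standard.
-/

open scoped Matroid

namespace PercRepro

namespace S1

open Set

variable {α : Type}

/-- **The `e`-free partitions survive restriction**: for `S ⊆ E` and `e ∈ S`, the traces `A ∩ S` and
`(S ∖ e) ∖ A` of an `e`-free partition of `M` are one of `M ↾ S`. -/
theorem hfree_restrict (M : Matroid α)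
    (hfree : ∀ e ∈ M.E, ∃ A ⊆ M.E \ {e}, e ∉ M.closure A ∧ e ∉ M.closure ((M.E \ {e}) \ A))
    {S : Set α} (hS : S ⊆ M.E) :
    ∀ e ∈ (M ↾ S).E, ∃ A ⊆ (M ↾ S).E \ {e},
      e ∉ (M ↾ S).closure A ∧ e ∉ (M ↾ S).closure (((M ↾ S).E \ {e}) \ A) := by
  intro e he
  rw [Matroid.restrict_ground_eq] at he
  obtain ⟨A, hA, h1, h2⟩ := hfree e (hS he)
  refine ⟨A ∩ S, ?_, ?_, ?_⟩
  · rw [Matroid.restrict_ground_eq]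
    intro z hz
    exact ⟨hz.2, (hA hz.1).2⟩
  · rw [Matroid.restrict_closure_eq M Set.inter_subset_right hS]
    intro h
    exact h1 (M.closure_subset_closure Set.inter_subset_left h.1)
  · rw [Matroid.restrict_ground_eq, Matroid.restrict_closure_eq M (fun z hz => hz.1.1) hS]
    intro h
    refine h2 (M.closure_subset_closure ?_ h.1)
    intro z hz
    obtain ⟨⟨hzS, hze⟩, hzA⟩ := hz
    exact ⟨⟨hS hzS, hze⟩, fun hzA' => hzA ⟨hzA', hzS⟩⟩

/-- **The triangle cap on a subset**: the triangles inside `S ⊆ E` number at most `cq3 (ν(S))`, `ν(S)` the nullity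
of `S` (`|S| = r(S) + ν`), by p3's `core_ncard_triangles_le_cq3` on the restriction `M ↾ S`. -/
theorem ncard_triangles_subset_le_cq3 (M : Matroid α) [M.Finite]
    (hfree : ∀ e ∈ M.E, ∃ A ⊆ M.E \ {e}, e ∉ M.closure A ∧ e ∉ M.closure ((M.E \ {e}) \ A))
    {S : Set α} (hS : S ⊆ M.E) {ν : ℕ} (hν : S.encard = M.eRk S + ν) :
    {C : Set α | M.IsCircuit C ∧ C.ncard = 3 ∧ C ⊆ S}.ncard ≤ TriangleCap.cq3 ν := by
  haveI : (M ↾ S).Finite := M.restrict_finite (M.ground_finite.subset hS)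
  have hfree' := hfree_restrict M hfree hS
  have hd : (M ↾ S).E.encard = (M ↾ S).eRank + ν := by
    rw [Matroid.restrict_ground_eq, Matroid.eRank_restrict]; exact hν
  have h := TriangleCap.core_ncard_triangles_le_cq3 (M ↾ S) hfree' hd
  have heq : {C : Set α | (M ↾ S).IsCircuit C ∧ C.ncard = 3} =
      {C : Set α | M.IsCircuit C ∧ C.ncard = 3 ∧ C ⊆ S} := by
    ext C
    simp only [Set.mem_setOf_eq, Matroid.restrict_isCircuit_iff hS]
    tauto
  rwa [heq] at h

/-- **THE CHAIN DICHOTOMY**: for `r ≥ 1` with `cq3 (r − 1) < s₃` (and `cq3 ν ≤ cq3 (r − 1)` for `ν < r`)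
there are `S ⊆ E` of nullity `≥ r` and a pairwise disjoint family `𝒟 ≠ ∅` of triangles inside `S` such that EITHER
`|𝒟| ≤ r`, `|S| ≤ 2r + |𝒟|` and at most `s₃ − r` triangles lie outside `S` (the greedy chain of `r` triangles), OR
`|𝒟| < r`, `|S| + 2 ≤ 2r + |𝒟|` and every triangle lies inside `S` (the chain stopped early; the nullity then comes
from the restriction cap `cq3`). -/
theorem exists_chain_set (M : Matroid α) [M.Finite]
    (hfree : ∀ e ∈ M.E, ∃ A ⊆ M.E \ {e}, e ∉ M.closure A ∧ e ∉ M.closure ((M.E \ {e}) \ A))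
    (r : ℕ) (hr1 : 1 ≤ r)
    (hcq : TriangleCap.cq3 (r - 1) < (ThmN.triangles M).ncard)
    (hmono : ∀ ν < r, TriangleCap.cq3 ν ≤ TriangleCap.cq3 (r - 1)) :
    ∃ S ⊆ M.E, ∃ 𝒟 : Finset (Set α), (∀ C ∈ 𝒟, M.IsCircuit C ∧ C.ncard = 3 ∧ C ⊆ S) ∧
      (∀ C ∈ 𝒟, ∀ C' ∈ 𝒟, C ≠ C' → Disjoint C C') ∧ 1 ≤ 𝒟.card ∧
      M.eRk S + (r : ℕ∞) ≤ (S.ncard : ℕ∞) ∧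
      ((𝒟.card ≤ r ∧ S.ncard ≤ 2 * r + 𝒟.card ∧
          {C : Set α | M.IsCircuit C ∧ C.ncard = 3 ∧ ¬ C ⊆ S}.ncard + r ≤ (ThmN.triangles M).ncard) ∨
        (𝒟.card + 1 ≤ r ∧ S.ncard + 2 ≤ 2 * r + 𝒟.card ∧ ∀ C, M.IsCircuit C → C.ncard = 3 → C ⊆ S)) := by
  classical
  have hEfin : M.E.Finite := M.ground_finite
  have htfin : (ThmN.triangles M).Finite := hEfin.finite_subsets.subset (fun C hC => hC.1.subset_ground)
  set 𝒯 := htfin.toFinset with h𝒯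
  have hmem𝒯 : ∀ C, C ∈ 𝒯 ↔ M.IsCircuit C ∧ C.ncard = 3 := fun C => by
    rw [h𝒯, Set.Finite.mem_toFinset]; rfl
  have h𝒯card : 𝒯.card = (ThmN.triangles M).ncard := (Set.ncard_eq_toFinset_card _ htfin).symm
  -- the invariant after `j` steps
  set P : ℕ → Prop := fun j => ∃ S ⊆ M.E, ∃ 𝒟 : Finset (Set α),
    (∀ C ∈ 𝒟, C ∈ 𝒯 ∧ C ⊆ S) ∧ (∀ C ∈ 𝒟, ∀ C' ∈ 𝒟, C ≠ C' → Disjoint C C') ∧ 𝒟.card ≤ j ∧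
    S.ncard ≤ 2 * j + 𝒟.card ∧ M.eRk S + (j : ℕ∞) ≤ (S.ncard : ℕ∞) ∧
    (∃ 𝒯' ⊆ 𝒯, 𝒯'.card = j ∧ ∀ C ∈ 𝒯', C ⊆ S) ∧ (1 ≤ 𝒟.card ∨ j = 0) with hP
  -- the early stop
  set Q : Prop := ∃ S ⊆ M.E, ∃ 𝒟 : Finset (Set α), ∃ j, j < r ∧
    (∀ C ∈ 𝒟, C ∈ 𝒯 ∧ C ⊆ S) ∧ (∀ C ∈ 𝒟, ∀ C' ∈ 𝒟, C ≠ C' → Disjoint C C') ∧ 1 ≤ 𝒟.card ∧ 𝒟.card ≤ j ∧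
    S.ncard ≤ 2 * j + 𝒟.card ∧ (∀ C ∈ 𝒯, C ⊆ S) with hQ
  have hchain : ∀ j, j ≤ r → P j ∨ Q := by
    intro j
    induction j with
    | zero =>
      intro _
      left
      refine ⟨∅, Set.empty_subset _, ∅, by simp, by simp, by simp, by simp, by simp, ⟨∅, Finset.empty_subset _, rfl,
        by simp⟩, Or.inr rfl⟩
    | succ j ih =>
      intro hjr
      rcases ih (by omega) with ⟨S, hS, 𝒟, h𝒟mem, h𝒟disj, h𝒟card, hScard, hν, ⟨𝒯', h𝒯'sub, h𝒯'card, h𝒯'in⟩, h𝒟pos⟩ | hQ'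
      · by_cases hex : ∃ C ∈ 𝒯, ¬ C ⊆ S
        · obtain ⟨C, hC, hCS⟩ := hex
          left
          have hC' := (hmem𝒯 C).1 hC
          have hCE : C ⊆ M.E := hC'.1.subset_ground
          have hCfin : C.Finite := hEfin.subset hCE
          have hSfin : S.Finite := hEfin.subset hS
          have hC𝒟 : C ∉ 𝒟 := fun h => hCS (h𝒟mem C h).2
          have hν' := eRk_union_triangle_add_le M hS hC' hCS hν
          have hchain𝒯' : ∃ 𝒯'' ⊆ 𝒯, 𝒯''.card = j + 1 ∧ ∀ D ∈ 𝒯'', D ⊆ S ∪ C := by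
            refine ⟨insert C 𝒯', Finset.insert_subset hC h𝒯'sub, ?_, ?_⟩
            · rw [Finset.card_insert_of_notMem (fun h => hCS (h𝒯'in C h)), h𝒯'card]
            · intro D hD
              rw [Finset.mem_insert] at hD
              rcases hD with rfl | hD
              · exact Set.subset_union_right
              · exact (h𝒯'in D hD).trans Set.subset_union_left
          by_cases hdisj : ∀ D ∈ 𝒟, Disjoint C D
          · -- `C` joins the disjoint family; the union grows by `≤ 3`
            refine ⟨S ∪ C, Set.union_subset hS hCE, insert C 𝒟, ?_, ?_, ?_, ?_, hν', hchain𝒯', ?_⟩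
            · intro D hD
              rw [Finset.mem_insert] at hD
              rcases hD with rfl | hD
              · exact ⟨hC, Set.subset_union_right⟩
              · exact ⟨(h𝒟mem D hD).1, (h𝒟mem D hD).2.trans Set.subset_union_left⟩
            · intro D hD D' hD' hne
              rw [Finset.mem_insert] at hD hD'
              rcases hD with rfl | hD <;> rcases hD' with rfl | hD'
              · exact absurd rfl hne
              · exact hdisj D' hD'
              · exact (hdisj D hD).symm
              · exact h𝒟disj D hD D' hD' hne
            · rw [Finset.card_insert_of_notMem hC𝒟]; omega
            · rw [Finset.card_insert_of_notMem hC𝒟]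
              have := Set.ncard_union_le S C
              rw [hC'.2] at this
              omega
            · left; rw [Finset.card_insert_of_notMem hC𝒟]; omega
          · -- `C` meets the disjoint family, hence `S`: the union grows by `≤ 2`
            push Not at hdisj
            obtain ⟨D, hD, hCD⟩ := hdisj
            have hSC : (S ∩ C).Nonempty := by
              rw [Set.not_disjoint_iff_nonempty_inter] at hCD
              obtain ⟨x, hxC, hxD⟩ := hCD
              exact ⟨x, (h𝒟mem D hD).2 hxD, hxC⟩
            have h1 : 1 ≤ (S ∩ C).ncard := (Set.ncard_pos (hSfin.subset Set.inter_subset_left)).2 hSC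
            have hcard : (S ∪ C).ncard + (S ∩ C).ncard = S.ncard + C.ncard :=
              Set.ncard_union_add_ncard_inter S C hSfin hCfin
            refine ⟨S ∪ C, Set.union_subset hS hCE, 𝒟, ?_, h𝒟disj, by omega, ?_, hν', hchain𝒯', ?_⟩
            · intro D' hD'
              exact ⟨(h𝒟mem D' hD').1, (h𝒟mem D' hD').2.trans Set.subset_union_left⟩
            · rw [hC'.2] at hcard; omega
            · left
              rcases h𝒟pos with h | h
              · exact h
              · -- `j = 0` forces `S = ∅`, but `D ⊆ S` has three points
                exfalso
                have hD' := (hmem𝒯 D).1 (h𝒟mem D hD).1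
                have := Set.ncard_le_ncard (h𝒟mem D hD).2 hSfin
                omega
        · right
          push Not at hex
          rcases h𝒟pos with h | h
          · exact ⟨S, hS, 𝒟, j, by omega, h𝒟mem, h𝒟disj, h, h𝒟card, hScard, hex⟩
          · -- `j = 0`: no triangle at all, against `cq3 (r − 1) < s₃`
            exfalso
            have hSfin : S.Finite := hEfin.subset hS
            have h𝒯empty : 𝒯 = ∅ := by
              rw [Finset.eq_empty_iff_forall_notMem]
              intro C hC
              have hC' := (hmem𝒯 C).1 hC
              have := Set.ncard_le_ncard (hex C hC) hSfin
              omega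
            rw [← h𝒯card, h𝒯empty, Finset.card_empty] at hcq
            omega
      · right; exact hQ'
  rcases hchain r le_rfl with ⟨S, hS, 𝒟, h𝒟mem, h𝒟disj, h𝒟card, hScard, hν, ⟨𝒯', h𝒯'sub, h𝒯'card, h𝒯'in⟩, h𝒟pos⟩ |
    ⟨S, hS, 𝒟, j, hjr, h𝒟mem, h𝒟disj, h𝒟pos, h𝒟card, hScard, hall⟩
  · -- the chain of `r` triangles
    have h𝒟pos' : 1 ≤ 𝒟.card := by
      rcases h𝒟pos with h | h
      · exact h
      · omega
    refine ⟨S, hS, 𝒟, fun C hC => ⟨((hmem𝒯 C).1 (h𝒟mem C hC).1).1, ((hmem𝒯 C).1 (h𝒟mem C hC).1).2,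
      (h𝒟mem C hC).2⟩, h𝒟disj, h𝒟pos', hν, Or.inl ⟨h𝒟card, hScard, ?_⟩⟩
    have hsub : {C : Set α | M.IsCircuit C ∧ C.ncard = 3 ∧ ¬ C ⊆ S} ⊆ ((𝒯 \ 𝒯' : Finset (Set α)) : Set (Set α)) := by
      intro C hC
      rw [Finset.mem_coe, Finset.mem_sdiff, hmem𝒯]
      exact ⟨⟨hC.1, hC.2.1⟩, fun h => hC.2.2 (h𝒯'in C h)⟩
    have h1 := Set.ncard_le_ncard hsub (Finset.finite_toSet _)
    rw [Set.ncard_coe_finset, Finset.card_sdiff_of_subset h𝒯'sub, h𝒯'card, h𝒯card] at h1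
    have h2 : r ≤ (ThmN.triangles M).ncard := by
      rw [← h𝒯card, ← h𝒯'card]; exact Finset.card_le_card h𝒯'sub
    omega
  · -- every triangle inside `S`: the restriction cap gives the nullity
    have hSfin : S.Finite := hEfin.subset hS
    have hrS : M.eRk S ≠ ⊤ := ((M.eRk_le_encard S).trans_lt hSfin.encard_lt_top).ne
    obtain ⟨a, ha⟩ := ENat.ne_top_iff_exists.1 hrS
    have haS : a ≤ S.ncard := by
      have h := M.eRk_le_encard S
      rw [← ha, ← hSfin.cast_ncard_eq] at h
      exact_mod_cast h
    have hν : S.encard = M.eRk S + ((S.ncard - a : ℕ) : ℕ∞) := by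
      rw [← ha, ← hSfin.cast_ncard_eq]
      norm_cast
      omega
    have hcap := ncard_triangles_subset_le_cq3 M hfree hS hν
    have hall' : {C : Set α | M.IsCircuit C ∧ C.ncard = 3 ∧ C ⊆ S} = ThmN.triangles M := by
      ext C
      simp only [Set.mem_setOf_eq]
      constructor
      · rintro ⟨h1, h2, -⟩; exact ⟨h1, h2⟩
      · rintro ⟨h1, h2⟩; exact ⟨h1, h2, hall C ((hmem𝒯 C).2 ⟨h1, h2⟩)⟩
    rw [hall'] at hcap
    have hνr : r ≤ S.ncard - a := by
      by_contra hlt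
      push Not at hlt
      have := hmono (S.ncard - a) hlt
      omega
    refine ⟨S, hS, 𝒟, fun C hC => ⟨((hmem𝒯 C).1 (h𝒟mem C hC).1).1, ((hmem𝒯 C).1 (h𝒟mem C hC).1).2,
      (h𝒟mem C hC).2⟩, h𝒟disj, h𝒟pos, ?_, Or.inr ⟨by omega, by omega, fun C hC h3 => hall C ((hmem𝒯 C).2 ⟨hC, h3⟩)⟩⟩
    rw [← ha]
    have : a + r ≤ S.ncard := by omega
    exact_mod_cast this

end S1

end PercRepro
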